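import Summits.BirchSwinnertonDyer.Rank1Residual.GaloisImage.KuriharaSelmerShaBookkeeping
import HarnessLib

/-!
# Route `KimAtThreeKolyvagin` (rung W2), crux `DeepUpperAtThree`: `#Sel_{p^K}(E/ℚ) = #Ш(E/ℚ)[p^∞]`
# at a DEEP level (rank `0`, `E[p]` irreducible) — the identification the UPPER ledger needs

Cell `bsd-addord`, seat `bsd-addord-w2-c3` (D-0074 row B6), item `stmt-BirchSwinnertonDyer-19076`.
Cell n1011's `SelmerSha.card_dvd_and_nsmul_eq_zero` (`GaloisImage/KuriharaSelmerShaBookkeeping.lean`)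
gives `#Sel_{p^K}(E/ℚ) ∣ #Ш(E/ℚ)[p^∞]` — the direction their LOWER bound (`p^β ∣ #Sel_{p^K}`) consumes.
The UPPER ledger of this seat (`KimAtThreeDeepUpperLedger`: `#Sel_{p^K} ∣ p^{t+v−α}`) needs the
converse at a DEEP level: once `p^K` kills `Ш[p^∞]`, the injection `Sel_{p^K} ≅ Ш ∩ H¹[p^K] ↪ Ш[p^∞]`
of their proof is ONTO, so `#Sel_{p^K}(E/ℚ) = #Ш(E/ℚ)[p^∞]`:

* `SelmerShaUpper.card_primaryComponent_dvd_natCard_selmerGroup_kummer` — `#Ш[p^∞] ∣ p^{k+1}` ⟹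
  `#Ш(E/ℚ)[p^∞] ∣ #Sel_{p^{k+1}}(E/ℚ)`;
* `SelmerShaUpper.natCard_selmerGroup_kummer_eq_card_primaryComponent` — hence equality;
* `SelmerShaUpper.padicValNat_card_primaryComponent_le_of_dvd_pow` — the reading the upper END
  theorem wants: `#Sel_{p^{k+1}} ∣ p^β` and `#Ш[p^∞] ∣ p^{k+1}` ⟹ `ord_p #Ш(E/ℚ)(p) ≤ β`.

Hypotheses: `E(ℚ)` finite (analytic rank `0` via GZK), `Ш` finite, `E[p]` irreducible (tower); the
Selmer group is the classical one at the modulus `p^k · p` of the propagated structure, as in n1011's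
ledgers. TOOL theorems (credit: the injection is n1011's `SelmerSha.selmer_injOn_and_map_eq`);
nothing asserted about any curve. [cite: SilvermanAEC2009, Thm. X.4.2 (a)] [cite: Mazur1977, Ch. III §5, p. 157]
-/

set_option autoImplicit false
-- the Theorems namespace of a single-conjunct summit repeats the summit name by design (D-0017)
set_option linter.dupNamespace false

noncomputable section

open WeierstrassCurve Literature.NumberTheory.EllipticCurves

namespace Summit.BirchSwinnertonDyer.BirchSwinnertonDyer.Theorems.KimAtThreeDeepUpperSelmerSha

open Summit.BirchSwinnertonDyer.Rank1Residual.GaloisImage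

namespace SelmerShaUpper

variable (W : WeierstrassCurve ℚ) [W.IsElliptic] (p : ℕ) [hp : Fact p.Prime]

/-- **`Sel_{p^{k+1}}(E/ℚ) ≃ Ш(E/ℚ)[p^∞]` when `p^{k+1}` kills `Ш[p^∞]`** (rank `0`: `E(ℚ)` finite;
`E[p]` irreducible; `Ш` finite): the map `H¹(ℚ, E[n]) → H¹(ℚ, E)` restricted to the Selmer group is
injective with image `Ш ∩ H¹[n]` (n1011's `SelmerSha.selmer_injOn_and_map_eq`), which is all of
`Ш[p^∞]` once `#Ш[p^∞] ∣ n = p^{k+1}`. Stated as the equality of cardinalities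
`#Sel_{p^{k+1}}(E/ℚ) = #Ш(E/ℚ)[p^∞]` for the classical Selmer structure at the modulus `p^k · p`.
[cite: SilvermanAEC2009, Thm. X.4.2 (a)] [cite: Mazur1977, Ch. III §5, p. 157] -/
theorem natCard_selmerGroup_kummer_eq_card_primaryComponent [Finite W.toAffine.Point] [Finite W.sha]
    (hirr : W.HasIrreducibleModPGaloisRep p) (k : ℕ)
    (hK : Nat.card (AddCommGroup.primaryComponent W.sha p) ∣ p ^ (k + 1)) :
    Nat.card (W.kummerSelmerStructure ((p : ℤ) ^ k * (p : ℤ))).selmerGroup =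
      Nat.card (AddCommGroup.primaryComponent W.sha p) := by
  suffices key : ∀ m : ℤ, m = ((p ^ (k + 1) : ℕ) : ℤ) →
      Nat.card (W.kummerSelmerStructure m).selmerGroup =
        Nat.card (AddCommGroup.primaryComponent W.sha p) from
    key _ (by push_cast; ring)
  intro m hm
  subst hm
  set n : ℤ := ((p ^ (k + 1) : ℕ) : ℤ) with hn
  obtain ⟨hinj, hmap⟩ := SelmerSha.selmer_injOn_and_map_eq W p hirr (k + 1)
  rw [← selmerGroup_eq_selmerGroup_kummerSelmerStructure]
  set T := W.torsionH1ToH1 n with hT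
  -- the image `Ш ∩ H¹[n]` sits inside `Ш[p^∞]` (as in n1011's `card_dvd_and_nsmul_eq_zero`)
  have himage : ∀ c ∈ W.selmerGroup n, ∃ hc : T c ∈ W.sha,
      (⟨T c, hc⟩ : W.sha) ∈ AddCommGroup.primaryComponent W.sha p := by
    intro c hc
    have h : T c ∈ (W.selmerGroup n).map T := ⟨c, hc, rfl⟩
    rw [hmap] at h
    refine ⟨h.1, ?_⟩
    rw [AddCommGroup.mem_primaryComponent]
    refine ⟨k + 1, Subtype.ext ?_⟩
    simpa using AddSubgroup.torsionBy.nsmul_iff.1 h.2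
  -- the restricted map `Sel_n → Ш[p^∞]` as an injective homomorphism
  let φ : W.selmerGroup n →+ AddCommGroup.primaryComponent W.sha p :=
    { toFun := fun c => ⟨⟨T c.1, (himage c.1 c.2).1⟩, (himage c.1 c.2).2⟩
      map_zero' := by ext; simp
      map_add' := fun x y => by ext; simp }
  have hφ : Function.Injective φ := by
    intro x y h
    have h' : T x.1 = T y.1 := by
      simpa [φ] using congrArg (fun z : AddCommGroup.primaryComponent W.sha p => (z.1 : W.galH1)) h
    have h0 : T (x.1 - y.1) = 0 := by rw [map_sub, h', sub_self]
    exact Subtype.ext (sub_eq_zero.1 (hinj _ (sub_mem x.2 y.2) h0))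
  -- … and ONTO, because `p^{k+1}` kills `Ш[p^∞]`
  have hφs : Function.Surjective φ := by
    intro y
    have hy0 : p ^ (k + 1) • y = 0 := by
      obtain ⟨r, hr⟩ := hK
      have h1 : Nat.card (AddCommGroup.primaryComponent W.sha p) • y = 0 :=
        addOrderOf_dvd_iff_nsmul_eq_zero.1 (addOrderOf_dvd_natCard y)
      rw [hr, mul_comm, mul_smul, h1, smul_zero]
    have hmem : ((y : W.sha) : W.galH1) ∈ W.sha ⊓ AddSubgroup.torsionBy W.galH1 n := by
      refine ⟨(y : W.sha).2, ?_⟩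
      have h2 := congrArg (fun z : AddCommGroup.primaryComponent W.sha p => ((z : W.sha) : W.galH1)) hy0
      simp only [AddSubgroupClass.coe_nsmul, ZeroMemClass.coe_zero] at h2
      exact AddSubgroup.torsionBy.nsmul_iff.2 h2
    rw [← hmap] at hmem
    obtain ⟨c, hc, hcy⟩ := hmem
    exact ⟨⟨c, hc⟩, Subtype.ext (Subtype.ext hcy)⟩
  exact Nat.card_congr (Equiv.ofBijective φ ⟨hφ, hφs⟩)

/-- **Hence `#Ш(E/ℚ)[p^∞] ∣ #Sel_{p^{k+1}}(E/ℚ)`** (the converse of n1011's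
`SelmerSha.card_dvd_and_nsmul_eq_zero`, at a deep level). [cite: SilvermanAEC2009, Thm. X.4.2 (a)] -/
theorem card_primaryComponent_dvd_natCard_selmerGroup_kummer [Finite W.toAffine.Point] [Finite W.sha]
    (hirr : W.HasIrreducibleModPGaloisRep p) (k : ℕ)
    (hK : Nat.card (AddCommGroup.primaryComponent W.sha p) ∣ p ^ (k + 1)) :
    Nat.card (AddCommGroup.primaryComponent W.sha p) ∣
      Nat.card (W.kummerSelmerStructure ((p : ℤ) ^ k * (p : ℤ))).selmerGroup :=
  dvd_of_eq (natCard_selmerGroup_kummer_eq_card_primaryComponent W p hirr k hK).symm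

/-- **The reading the upper END theorem wants**: at a deep level (`#Ш[p^∞] ∣ p^{k+1}`), an upper
divisibility `#Sel_{p^{k+1}}(E/ℚ) ∣ p^β` (the upper ledger's output, `β = t + v − α`) gives
`ord_p #Ш(E/ℚ)(p) ≤ β`. [cite: SilvermanAEC2009, Thm. X.4.2 (a)] [cite: Kim2022StructureSelmer, Thm. 1.9 (6)] -/
theorem padicValNat_card_primaryComponent_le_of_dvd_pow [Finite W.toAffine.Point] [Finite W.sha]
    (hirr : W.HasIrreducibleModPGaloisRep p) (k : ℕ)
    (hK : Nat.card (AddCommGroup.primaryComponent W.sha p) ∣ p ^ (k + 1)) {β : ℕ}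
    (hup : Nat.card (W.kummerSelmerStructure ((p : ℤ) ^ k * (p : ℤ))).selmerGroup ∣ p ^ β) :
    padicValNat p (Nat.card (AddCommGroup.primaryComponent W.sha p)) ≤ β := by
  rw [natCard_selmerGroup_kummer_eq_card_primaryComponent W p hirr k hK] at hup
  have hpos : 0 < Nat.card (AddCommGroup.primaryComponent W.sha p) := Nat.card_pos
  obtain ⟨i, hi, hcard⟩ := (Nat.dvd_prime_pow hp.out).1 hup
  rw [hcard, padicValNat.prime_pow]
  exact hi

end SelmerShaUpper

end Summit.BirchSwinnertonDyer.BirchSwinnertonDyer.Theorems.KimAtThreeDeepUpperSelmerSha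

end
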